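import Summits.AnomalousDissipation.AnomalousDissipation.Theorems.MomentParityGalerkinLiouville

/-!
# Route MomentParity · `GalerkinEnsembleRealization` — from the generator identity on cylindrical
  tests to the Liouville equation on the Galerkin phase space

For a `C¹` function `ψ` on the level-`N` coefficient space, the cylindrical test functional
`Φ_ψ(u) = ψ(∑ᵢ (u, gᵢ) ĝᵢ|_S) · χ(|P_N u|²)` over the Parseval frame `gᵢ` of `P_N H` (profile cut
off by the bump `χ` outside the energy ball) has band-limited fields, and on band-limited `U ∈ H`
in the ball its tested generator is `⟨F(U), Φ_ψ'(U)⟩ = Dψ(Û|_S)[galerkinRHS(Û|_S)]`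
(`MomentParityGalerkinLiouville`). Hence a probability measure on `H` carried by band-limited
fields of the energy ball which annihilates the generator on every band-limited cylindrical test
(the hypothesis of `GalerkinEnsembleRealization`) pushes forward, under `U ↦ Û|_S`, to a measure
satisfying the stationary Liouville equation of the Galerkin system
(`integral_fderiv_galerkinRHS_comp_eq_zero`; stmt-AnomalousDissipation-11466).
-/

noncomputable section

set_option linter.dupNamespace false

open MeasureTheory Set Filter Topology Function
open scoped BigOperators InnerProductSpace RealInnerProductSpace

namespace Summit.AnomalousDissipation.AnomalousDissipation.Theorems.MomentParity

open Literature.Analysis.FunctionSpaces Literature.Analysis.FunctionSpaces.Torus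
open Literature.Analysis.FluidPDE Literature.Analysis.FluidPDE.Torus

/-- Local notation: the flat three-torus. -/
local notation "𝕋3" => UnitAddTorus (Fin 3)
/-- Local notation: velocity values. -/
local notation "E3" => EuclideanSpace ℝ (Fin 3)
/-- Local notation: the `L²` space of velocity fields. -/
local notation "L2" => Lp (EuclideanSpace ℝ (Fin 3)) 2 (volume : Measure (UnitAddTorus (Fin 3)))
/-- The Fourier coefficients of a real field (shorthand used in statements). -/
local notation "𝓕" v => UnitAddTorus.mFourierCoeff (EuclideanSpace.complexify ∘ v)

/-- **The generator identity on band-limited cylindrical tests implies the Liouville equation of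
the Galerkin system for the law of the coefficients.** Let `μ` be a probability measure on `H`
carried by fields band-limited to `0 < |k|² ≤ N²` with `|u| ≤ R`, such that
`∫ ⟨F(u), Φ'(u)⟩ dμ = 0` for every cylindrical `Φ` with band-limited fields (`f ∈ L²` mean zero).
Then for every `C¹` function `ψ` on the coefficient space,
`∫ Dψ(û|_S)[galerkinRHS(f̂|_S, û|_S)] dμ(u) = 0`, the integrand being integrable. -/
theorem integral_fderiv_galerkinRHS_comp_eq_zero {N : ℕ} (ν : ℝ) {f : 𝕋3 → E3}
    (hf : MemLp f 2 volume) (hf0 : Torus.HasZeroMean f) {R : ℝ}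
    {μ : Measure (Torus.energySpace (Fin 3))} [IsProbabilityMeasure μ]
    (h1 : ∀ᵐ u ∂μ, ∀ k ∉ (freqBall N).erase (0 : Fin 3 → ℤ), (𝓕 (u.1 : 𝕋3 → E3)) k = 0)
    (h2 : ∀ᵐ u ∂μ, ‖u‖ ≤ R)
    (h4 : ∀ Φ : CylindricalTest (Fin 3),
      (∀ i, ∀ k ∉ (freqBall N).erase (0 : Fin 3 → ℤ), (𝓕 (Φ.g i)) k = 0) →
        Integrable (fun u => nsGeneratorPairing ν f u (Φ.grad u)) μ ∧
          ∫ u, nsGeneratorPairing ν f u (Φ.grad u) ∂μ = 0)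
    {ψ : (↥(freqBall (d := Fin 3) N) → EuclideanSpace ℂ (Fin 3)) → ℝ} (hψ : ContDiff ℝ 1 ψ) :
    Integrable (fun u : Torus.energySpace (Fin 3) => fderiv ℝ ψ (fourierRestrict (freqBall N) (u.1 : 𝕋3 → E3))
        (galerkinRHS (freqBall N) ν (fourierRestrict (freqBall N) f)
          (fourierRestrict (freqBall N) (u.1 : 𝕋3 → E3)))) μ ∧
      ∫ u : Torus.energySpace (Fin 3), fderiv ℝ ψ (fourierRestrict (freqBall N) (u.1 : 𝕋3 → E3))
        (galerkinRHS (freqBall N) ν (fourierRestrict (freqBall N) f)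
          (fourierRestrict (freqBall N) (u.1 : 𝕋3 → E3))) ∂μ = 0 := by
  classical
  have hS : ∀ k ∈ freqBall (d := Fin 3) N, -k ∈ freqBall (d := Fin 3) N := neg_mem_freqBall_of_mem
  -- the frame, reindexed by `Fin m` (kept opaque)
  obtain ⟨m, ⟨eqv⟩⟩ : ∃ m : ℕ, Nonempty (Fin m ≃ Torus.FrameIdx (Fin 3) N) :=
    ⟨_, ⟨(Fintype.equivFin (Torus.FrameIdx (Fin 3) N)).symm⟩⟩
  obtain ⟨g, hg⟩ : ∃ g : Fin m → 𝕋3 → E3, ∀ i, g i = Torus.frameFieldIdx N (eqv i) := ⟨_, fun i => rfl⟩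
  have hB : ∀ i, Torus.IsSmooth (g i) ∧ Torus.IsDivFree (g i) ∧ Torus.HasZeroMean (g i) ∧
      ∀ k ∉ (freqBall N).erase (0 : Fin 3 → ℤ), (𝓕 (g i)) k = 0 := fun i => by
    rw [hg i]; exact MomentParityQuarticGate.frameFieldIdx_band N (eqv i)
  -- the linear reconstruction map `Λ ξ = ∑ᵢ ξᵢ ĝᵢ|_S`
  obtain ⟨Λ, hΛ⟩ : ∃ Λ : EuclideanSpace ℝ (Fin m) →L[ℝ] (↥(freqBall (d := Fin 3) N) → EuclideanSpace ℂ (Fin 3)),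
      ∀ ξ : EuclideanSpace ℝ (Fin m), Λ ξ = ∑ i, ξ i • fourierRestrict (freqBall N) (g i) :=
    ⟨∑ i : Fin m, (EuclideanSpace.proj i).smulRight (fourierRestrict (freqBall N) (g i)), fun ξ => by
      rw [FunLike.coe_sum, Finset.sum_apply]
      rfl⟩
  -- the cutoff scale and the profile (kept opaque)
  obtain ⟨a, hadef⟩ : ∃ a : ℝ, a = R ^ 2 + 1 := ⟨_, rfl⟩
  have ha : 0 < a := by rw [hadef]; positivity
  obtain ⟨φ, hφdef⟩ : ∃ φ : EuclideanSpace ℝ (Fin m) → ℝ,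
      φ = fun ξ => ψ (Λ ξ) * (galerkinCutoff : ℝ → ℝ) (‖ξ‖ ^ 2 / a) := ⟨_, rfl⟩
  have hφ1 : ContDiff ℝ 1 φ := by
    rw [hφdef]
    refine (hψ.comp Λ.contDiff).mul ?_
    exact (galerkinCutoff.contDiff (n := 1)).comp ((contDiff_norm_sq ℝ).div_const a)
  have hφc : HasCompactSupport φ := by
    refine HasCompactSupport.intro (isCompact_closedBall (0 : EuclideanSpace ℝ (Fin m))
      (Real.sqrt (2 * a))) fun ξ hξ => ?_
    rw [Metric.mem_closedBall, dist_zero_right, not_le] at hξ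
    have h2 : 2 * a < ‖ξ‖ ^ 2 := (Real.sqrt_lt' ((Real.sqrt_nonneg _).trans_lt hξ)).1 hξ
    have h3 : galerkinCutoff.rOut ≤ dist (‖ξ‖ ^ 2 / a) 0 := by
      rw [Real.dist_eq, sub_zero, abs_of_nonneg (by positivity)]
      show (2 : ℝ) ≤ ‖ξ‖ ^ 2 / a
      rw [le_div_iff₀ ha]
      linarith
    rw [hφdef]
    simp only [galerkinCutoff.zero_of_le_dist h3, mul_zero]
  -- the cylindrical test functional
  let Φ : CylindricalTest (Fin 3) :=
    { m := m
      g := g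
      g_smooth := fun i => (hB i).1
      g_divFree := fun i => (hB i).2.1
      g_zeroMean := fun i => (hB i).2.2.1
      φ := φ
      φ_contDiff := hφ1
      φ_compact := hφc }
  obtain ⟨hint, hzero⟩ := h4 Φ fun i => (hB i).2.2.2
  have hφE : Φ.φ = φ := rfl
  have hgE : ∀ i, Φ.g i = g i := fun i => rfl
  -- on the good set the tested generator is the Liouville integrand
  have hkey : ∀ u : Torus.energySpace (Fin 3),
      (∀ k ∉ (freqBall N).erase (0 : Fin 3 → ℤ), (𝓕 (u.1 : 𝕋3 → E3)) k = 0) → ‖u‖ ≤ R →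
      nsGeneratorPairing ν f u (Φ.grad u) =
        fderiv ℝ ψ (fourierRestrict (freqBall N) (u.1 : 𝕋3 → E3))
          (galerkinRHS (freqBall N) ν (fourierRestrict (freqBall N) f)
            (fourierRestrict (freqBall N) (u.1 : 𝕋3 → E3))) := by
    intro u hu huR
    have hfi : Integrable f volume := hf.integrable one_le_two
    -- the coordinate vector (kept opaque)
    obtain ⟨ξ₀, hξ₀def⟩ : ∃ ξ₀ : EuclideanSpace ℝ (Fin m),
        ξ₀ = WithLp.toLp 2 fun i => Torus.pairing u.1 (g i) := ⟨_, rfl⟩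
    have hcoordsE : Φ.coords u = ξ₀ := by rw [hξ₀def]; rfl
    have hξ₀i : ∀ i, ξ₀ i = Torus.pairing u.1 (g i) := fun i => by rw [hξ₀def]
    -- the coordinates lie in the ball where the cutoff is `1`
    have hcoords : ‖ξ₀‖ ^ 2 < a := by
      have h1 : ‖ξ₀‖ ^ 2 = ∫ y, ‖fourierTruncate N (u.1 : 𝕋3 → E3) y‖ ^ 2 := by
        rw [EuclideanSpace.real_norm_sq_eq, ← Torus.sum_integral_inner_frameField_sq u.2 N]
        simp_rw [hξ₀i, hg]
        rw [Equiv.sum_comp eqv (fun p => (Torus.pairing u.1 (Torus.frameFieldIdx N p)) ^ 2),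
          Fintype.sum_prod_type, ← Finset.sum_coe_sort (Torus.freqBall₀ N)]
        refine Finset.sum_congr rfl fun k _ => ?_
        rw [Fintype.sum_prod_type]
        rfl
      have h2 := integral_norm_sq_fourierTruncate_le (Lp.memLp u.1) N
      have h3 : ∫ y, ‖(u.1 : 𝕋3 → E3) y‖ ^ 2 = ‖u‖ ^ 2 := integral_norm_sq_coe_eq u.1
      have h4 : ‖u‖ ^ 2 ≤ R ^ 2 := by
        have h0 : 0 ≤ ‖u‖ := norm_nonneg _
        nlinarith
      rw [hadef]; linarith
    -- `Λ ξ₀ = û|_S`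
    have hΛc : Λ ξ₀ = fourierRestrict (freqBall N) (u.1 : 𝕋3 → E3) := by
      funext k
      rw [hΛ, Finset.sum_apply, fourierRestrict_apply,
        ← sum_pairing_smul_mFourierCoeff_frameFieldIdx N u k.2, ← Equiv.sum_comp eqv]
      refine Finset.sum_congr rfl fun i _ => ?_
      rw [Pi.smul_apply, fourierRestrict_apply, ← Complex.coe_smul, hξ₀i, hg]
    -- near `ξ₀` the profile is `ψ ∘ Λ`
    have hloc : φ =ᶠ[𝓝 ξ₀] fun ξ => ψ (Λ ξ) := by
      have hopen : IsOpen {ξ : EuclideanSpace ℝ (Fin m) | ‖ξ‖ ^ 2 < a} :=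
        isOpen_lt (continuous_norm.pow 2) continuous_const
      filter_upwards [hopen.mem_nhds hcoords] with ξ hξ
      have h1 : (galerkinCutoff : ℝ → ℝ) (‖ξ‖ ^ 2 / a) = 1 := by
        refine galerkinCutoff.one_of_mem_closedBall ?_
        rw [Metric.mem_closedBall, Real.dist_eq, sub_zero, abs_of_nonneg (by positivity)]
        show ‖ξ‖ ^ 2 / a ≤ 1
        rw [div_le_one ha]; exact le_of_lt hξ
      rw [hφdef]
      simp only [h1, mul_one]
    have hfd : ∀ i : Fin m, fderiv ℝ φ ξ₀ (EuclideanSpace.single i 1) =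
        fderiv ℝ ψ (fourierRestrict (freqBall N) (u.1 : 𝕋3 → E3)) (fourierRestrict (freqBall N) (g i)) := by
      intro i
      have hdψ : DifferentiableAt ℝ ψ (Λ ξ₀) := hψ.differentiable one_ne_zero (Λ ξ₀)
      have hcomp : fderiv ℝ (fun ξ => ψ (Λ ξ)) ξ₀ = (fderiv ℝ ψ (Λ ξ₀)).comp Λ := by
        have h := fderiv_comp ξ₀ hdψ Λ.differentiableAt
        rw [Λ.fderiv] at h
        exact h
      have hΛi : Λ (EuclideanSpace.single i 1) = fourierRestrict (freqBall N) (g i) := by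
        rw [hΛ]
        simp [Finset.sum_ite_eq']
      rw [hloc.fderiv_eq, hcomp, ContinuousLinearMap.comp_apply, hΛc, hΛi]
    -- linearity in the test field and the frame reconstruction of the Galerkin field
    have hgrad := nsGeneratorPairing_grad ν hfi Φ u
    rw [hcoordsE, hφE] at hgrad
    simp only [hgE] at hgrad
    rw [hgrad, Finset.sum_congr rfl fun i _ => by rw [hfd i]]
    have hrec := sum_nsGeneratorPairing_smul_fourierRestrict ν hf hf0 u hu
    rw [← Equiv.sum_comp eqv] at hrec
    simp only [← hg] at hrec
    rw [← hrec, map_sum]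
    refine Finset.sum_congr rfl fun i _ => ?_
    rw [map_smul, smul_eq_mul, mul_comm]
  have hae : (fun u : Torus.energySpace (Fin 3) => nsGeneratorPairing ν f u (Φ.grad u)) =ᵐ[μ]
      fun u => fderiv ℝ ψ (fourierRestrict (freqBall N) (u.1 : 𝕋3 → E3))
        (galerkinRHS (freqBall N) ν (fourierRestrict (freqBall N) f)
          (fourierRestrict (freqBall N) (u.1 : 𝕋3 → E3))) := by
    filter_upwards [h1, h2] with u hu huR using hkey u hu huR
  exact ⟨hint.congr hae, by rw [← integral_congr_ae hae]; exact hzero⟩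

end Summit.AnomalousDissipation.AnomalousDissipation.Theorems.MomentParity
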